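import Literature.Topology.FourManifolds.LatticeFormsOrthogonalGroupCommutatorsThreeU
import Literature.Topology.FourManifolds.LatticeFormsUnimodularTransvectionsReflections
import Literature.Topology.FourManifolds.LatticeFormsOverlatticeSignature
import HarnessLib

/-!
# `O⁺(U^{⊕3})` is generated by the `(−2)`-reflections and `[O(U^{⊕3}), O(U^{⊕3})] = SO⁺(U^{⊕3})` is perfect — for EVERY
# lattice isometric to `U ⊕ U ⊕ U`, in particular the standard model `hyperbolicSum 3`
# (Gritsenko–Hulek–Sankaran 2009 Thm. 1.1 (Kneser), Thm. 1.7, §4 for `L = 3U`; transport along isometries)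

Trunk T-4MAN vocabulary. The rows g49-#7…#9 proved, in the nested model `(H ⊕ H) ⊕ H`: `O⁺(3U) = ⟨σ_r : r² = −2⟩`
(`isWordIn_negTwoReflections_iff_isOrientationPreserving_threeU`), `[O(3U), O(3U)] = SO⁺(3U)` (`isWordIn_commutators_iff_threeU`)
and `SO⁺(3U)` perfect. This file makes the statements MODEL-FREE — for any integral lattice `(W′, B′)` with an isometry
`e : (H ⊕ H) ⊕ H ⥲ (W′, B′)` — by transporting words along `e` (`γ ↦ e γ e⁻¹` maps words in `S` to words in `e S e⁻¹`,
reflections to reflections, commutators to commutators; `O⁺` and `det` are conjugation invariant), and instantiates them for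
the tree's standard `U^{⊕3} = hyperbolicSum 3` (isometric to the nested model by the classification of indefinite unimodular
lattices, `equivalent_hyperbolicSum_of_signature_eq_zero`). Written for lane `lit-hodgefound` (Track 2 foundations; prover
seat `lit-hodgefound-p18`, gen 49, row g49-#13). THEOREMS ONLY — no definition, no named fact, no instance, no notation.

## Source, verbatim (held text `paper:arxiv-0810.1614`)

p. 3 "**Theorem 1.1** ([Kn1]) […] Then `O′(L)` is generated by the products of reflections `σ_aσ_b` where `a, b ∈ L` and
`a² = b² = −2`"; p. 4 "**Theorem 1.7** […] Then `S̃O⁺(L)^{ab}` is trivial and `Õ⁺(L)^{ab} ≅ ℤ/2ℤ`"; p. 8 "`Õ⁺(L) = ⟨S̃O⁺(L), σ_{e−f}⟩`";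
§3.1 p. 5 "(t4) `g t(e,a) g⁻¹ = t(g(e), g(a))` for `g ∈ O(L)`" and "`γσ_rγ⁻¹ = σ_{γ(r)}`" (transport of generators along
isometries).

## Contents (all proved)

* §1 transport along an isometry `e : (W,B) ⥲ (W′,B′)`: words (`IsWordIn.conj`), `(−2)`-reflection words
  (`IsWordIn.negTwoReflections_conj`), commutator words (`IsWordIn.commutators_conj`).
* §2 for `(W′, B′)` with an isometry `e : (H ⊕ H) ⊕ H ⥲ (W′, B′)`: **`O⁺(B′) = ⟨σ_r : B′(r,r) = −2⟩`**
  (`isWordIn_negTwoReflections_iff_isOrientationPreserving_of_isometryEquiv_threeU`), **`[O(B′), O(B′)] = SO⁺(B′)`**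
  (`isWordIn_commutators_iff_of_isometryEquiv_threeU`).
* §3 `(H ⊕ H) ⊕ H ≅ hyperbolicSum 3` (`nonempty_isometryEquiv_threeU_hyperbolicSum`) and the two statements for `U^{⊕3} =
  hyperbolicSum 3` (`hyperbolicSum_three_isWordIn_negTwoReflections_iff`, `hyperbolicSum_three_isWordIn_commutators_iff`).
-/

noncomputable section

open Module
open LinearMap (BilinForm)
open LinearMap.BilinForm
open LinearMap.BilinForm (IsometryEquiv)

namespace Literature.Topology.FourManifolds

/-! ### §1 Transport of words along an isometry -/

section Transport

variable {W W' : Type*} [AddCommGroup W] [AddCommGroup W'] {B : BilinForm ℤ W} {B' : BilinForm ℤ W'}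

/-- **`γ ↦ eγe⁻¹` maps words to words**: if `φ` is a word in `S ⊆ O(B)` and `e : (W,B) ⥲ (W′,B′)` is an isometry then
`e⁻¹·φ·e` (diagrammatic order: `e.symm.trans (φ.trans e)`, the map `v ↦ e(φ(e⁻¹v))`) is a word in
`{e⁻¹·ψ·e | ψ ∈ S}`. [cite: GritsenkoHulekSankaran2009, §3.1 (t4) ("g t(e,a) g⁻¹ = t(g(e), g(a))")] -/
theorem IsWordIn.conj {S : Set (B.IsometryEquiv B)} {φ : B.IsometryEquiv B} (hφ : IsWordIn S φ) (e : B.IsometryEquiv B') :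
    IsWordIn {ψ' : B'.IsometryEquiv B' | ∃ ψ ∈ S, ψ' = e.symm.trans (ψ.trans e)} (e.symm.trans (φ.trans e)) := by
  refine hφ.induction_on (P := fun χ ↦ IsWordIn {ψ' : B'.IsometryEquiv B' | ∃ ψ ∈ S, ψ' = e.symm.trans (ψ.trans e)}
    (e.symm.trans (χ.trans e))) (fun s hs ↦ IsWordIn.of_mem ⟨s, hs, rfl⟩) ?_ (fun ψ χ hψ hχ ↦ ?_) (fun ψ hψ ↦ ?_)
  · refine IsWordIn.refl.congr fun v ↦ ?_
    rw [LinearMap.BilinForm.IsometryEquiv.refl_apply, LinearMap.BilinForm.IsometryEquiv.trans_apply,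
      LinearMap.BilinForm.IsometryEquiv.trans_apply, LinearMap.BilinForm.IsometryEquiv.refl_apply,
      LinearMap.BilinForm.IsometryEquiv.apply_symm_apply]
  · refine (hψ.trans hχ).congr fun v ↦ ?_
    simp only [LinearMap.BilinForm.IsometryEquiv.trans_apply, LinearMap.BilinForm.IsometryEquiv.symm_apply_apply]
  · exact hψ.symm.congr fun v ↦ rfl

/-- **`γσ_rγ⁻¹ = σ_{γ(r)}`**: `e⁻¹·σ_r·e = σ_{e(r)}` pointwise, for an isometry `e : (W,B) ⥲ (W′,B′)`.
[cite: GritsenkoHulekSankaran2009, §3.1 ("γσ_rγ⁻¹ = σ_{γ(r)}") and Prop. 3.3 (iv) proof] -/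
theorem normTwoReflectionEquiv_conj_apply (hB : B.IsSymm) (hB' : B'.IsSymm) (e : B.IsometryEquiv B') {r : W} {ε : ℤ}
    (hr : B r r = ε + ε) (hε : ε * ε = 1) (hr' : B' (e r) (e r) = ε + ε) (v : W') :
    (e.symm.trans ((normTwoReflectionEquiv hB r ε hr hε).trans e)) v = normTwoReflectionEquiv hB' (e r) ε hr' hε v := by
  rw [LinearMap.BilinForm.IsometryEquiv.trans_apply, LinearMap.BilinForm.IsometryEquiv.trans_apply,
    normTwoReflectionEquiv_apply, normTwoReflectionEquiv_apply, ← LinearMap.BilinForm.normTwoReflection_apply,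
    ← LinearMap.BilinForm.normTwoReflection_apply, map_normTwoReflection_apply, LinearMap.BilinForm.IsometryEquiv.apply_symm_apply]

/-- **Words in `(−2)`-reflections transport along isometries**: if `φ` is a word in `{σ_r : B(r,r) = −2}` then `e⁻¹·φ·e` is a
word in `{σ_{r′} : B′(r′,r′) = −2}`. [cite: GritsenkoHulekSankaran2009, §3.1 ("γσ_rγ⁻¹ = σ_{γ(r)}")] -/
theorem IsWordIn.negTwoReflections_conj (hB : B.IsSymm) (hB' : B'.IsSymm) {φ : B.IsometryEquiv B}
    (hφ : IsWordIn {ψ : B.IsometryEquiv B | ∃ (r : W) (hr : B r r = -1 + -1), ψ = normTwoReflectionEquiv hB r (-1) hr (by norm_num)} φ)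
    (e : B.IsometryEquiv B') :
    IsWordIn {ψ' : B'.IsometryEquiv B' | ∃ (r : W') (hr : B' r r = -1 + -1), ψ' = normTwoReflectionEquiv hB' r (-1) hr (by norm_num)}
      (e.symm.trans (φ.trans e)) := by
  refine (hφ.conj e).bind fun s hs ↦ ?_
  obtain ⟨ψ, ⟨r, hr, rfl⟩, rfl⟩ := hs
  have hr' : B' (e r) (e r) = -1 + -1 := by rw [e.map_app, hr]
  exact IsWordIn.congr (IsWordIn.of_mem (φ := normTwoReflectionEquiv hB' (e r) (-1) hr' (by norm_num)) ⟨e r, hr', rfl⟩)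
    fun v ↦ (normTwoReflectionEquiv_conj_apply hB hB' e hr (by norm_num) hr' v).symm

/-- **Commutator words transport along isometries**: `e⁻¹·[α,β]·e = [e⁻¹αe, e⁻¹βe]`, so if `φ` is a word in commutators of
`O(B)` then `e⁻¹·φ·e` is a word in commutators of `O(B′)`. [cite: GritsenkoHulekSankaran2009, §3.1 (t4) and Cor. 1.8] -/
theorem IsWordIn.commutators_conj {φ : B.IsometryEquiv B}
    (hφ : IsWordIn {ψ : B.IsometryEquiv B | ∃ α β : B.IsometryEquiv B, ψ = ((β.symm.trans α.symm).trans β).trans α} φ)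
    (e : B.IsometryEquiv B') :
    IsWordIn {ψ' : B'.IsometryEquiv B' | ∃ α β : B'.IsometryEquiv B', ψ' = ((β.symm.trans α.symm).trans β).trans α}
      (e.symm.trans (φ.trans e)) := by
  refine (hφ.conj e).bind fun s hs ↦ ?_
  obtain ⟨ψ, ⟨α, β, rfl⟩, rfl⟩ := hs
  refine IsWordIn.congr (IsWordIn.of_mem (φ := (((e.symm.trans (β.trans e)).symm.trans (e.symm.trans (α.trans e)).symm).trans
      (e.symm.trans (β.trans e))).trans (e.symm.trans (α.trans e)))
    ⟨e.symm.trans (α.trans e), e.symm.trans (β.trans e), rfl⟩) fun v ↦ ?_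
  have hα : ∀ w, (e.symm.trans (α.trans e)).symm w = e (α.symm (e.symm w)) := fun _ ↦ rfl
  have hβ : ∀ w, (e.symm.trans (β.trans e)).symm w = e (β.symm (e.symm w)) := fun _ ↦ rfl
  simp only [LinearMap.BilinForm.IsometryEquiv.trans_apply, hα, hβ, LinearMap.BilinForm.IsometryEquiv.symm_apply_apply]

/-- `e⁻¹·(e·φ′·e⁻¹)·e = φ′` pointwise (bookkeeping). [cite: GritsenkoHulekSankaran2009, §3.1 (t4)] -/
theorem IsometryEquiv.symm_trans_trans_trans_symm_trans_apply (e : B.IsometryEquiv B') (φ' : B'.IsometryEquiv B') (v : W') :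
    (e.symm.trans ((e.trans (φ'.trans e.symm)).trans e)) v = φ' v := by
  simp only [LinearMap.BilinForm.IsometryEquiv.trans_apply, LinearMap.BilinForm.IsometryEquiv.apply_symm_apply]

/-- `det(e·φ′·e⁻¹) = det φ′` for an isometry `e : (W,B) ⥲ (W′,B′)`. [cite: GritsenkoHulekSankaran2009, Cor. 1.8 ("det" is a character)] -/
theorem IsometryEquiv.det_trans_trans_symm (e : B.IsometryEquiv B') (φ' : B'.IsometryEquiv B') :
    LinearMap.det ((e.trans (φ'.trans e.symm) : B.IsometryEquiv B) : W →ₗ[ℤ] W) = LinearMap.det (φ' : W' →ₗ[ℤ] W') := by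
  rw [show ((e.trans (φ'.trans e.symm) : B.IsometryEquiv B) : W →ₗ[ℤ] W) =
      ((e.toLinearEquiv.symm : W' ≃ₗ[ℤ] W) : W' →ₗ[ℤ] W) ∘ₗ (φ' : W' →ₗ[ℤ] W') ∘ₗ
        ((e.toLinearEquiv.symm.symm : W ≃ₗ[ℤ] W') : W →ₗ[ℤ] W') from LinearMap.ext fun _ ↦ rfl, LinearMap.det_conj]

end Transport

/-! ### §2 Any lattice isometric to `U ⊕ U ⊕ U` -/

section Isometric

variable {W' : Type} [AddCommGroup W'] [Module.Finite ℤ W'] [Module.Free ℤ W'] {B' : BilinForm ℤ W'}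

/-- **`O⁺(L) = ⟨σ_r : r² = −2⟩` for every lattice `L` isometric to `U ⊕ U ⊕ U`** (Kneser's theorem / "`Õ⁺ = ⟨S̃O⁺, σ_{e−f}⟩`"
for `L ≅ 3U`, transported from the nested model along `e`). [cite: GritsenkoHulekSankaran2009, Thm. 1.1 and §4] -/
theorem isWordIn_negTwoReflections_iff_isOrientationPreserving_of_isometryEquiv_threeU (hB' : B'.IsSymm)
    (hnd' : B'.Nondegenerate) (e : ((hyperbolicForm.prod hyperbolicForm).prod hyperbolicForm).IsometryEquiv B')
    (φ' : B'.IsometryEquiv B') :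
    IsWordIn {ψ' : B'.IsometryEquiv B' | ∃ (r : W') (hr : B' r r = -1 + -1), ψ' = normTwoReflectionEquiv hB' r (-1) hr (by norm_num)}
      φ' ↔ φ'.IsOrientationPreserving := by
  have hB : ((hyperbolicForm.prod hyperbolicForm).prod hyperbolicForm).IsSymm :=
    (isSymm_hyperbolicForm.prod isSymm_hyperbolicForm).prod isSymm_hyperbolicForm
  refine ⟨fun h ↦ (IsWordIn.isOrientationPreserving_and_congr_eq_refl_of_negTwoReflections _ hB' hnd' (fun s hs ↦ hs) h).1,
    fun h₁ ↦ ?_⟩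
  have hφ : (e.trans (φ'.trans e.symm)).IsOrientationPreserving :=
    (LinearMap.BilinForm.IsometryEquiv.isOrientationPreserving_trans_trans_symm_iff e φ').2 h₁
  have hw := (isWordIn_negTwoReflections_iff_isOrientationPreserving_threeU _).2 hφ
  exact (hw.negTwoReflections_conj hB hB' e).congr fun v ↦ IsometryEquiv.symm_trans_trans_trans_symm_trans_apply e φ' v

/-- **`[O(L), O(L)] = SO⁺(L)` for every lattice `L` isometric to `U ⊕ U ⊕ U`**: an isometry is a word in commutators iff it
lies in `O⁺` with `det = 1` (Thm. 1.7 / Cor. 1.8 for `L ≅ 3U`, transported along `e`). [cite: GritsenkoHulekSankaran2009, Thm. 1.7 and Cor. 1.8] -/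
theorem isWordIn_commutators_iff_of_isometryEquiv_threeU (hB' : B'.IsSymm) (hnd' : B'.Nondegenerate)
    (e : ((hyperbolicForm.prod hyperbolicForm).prod hyperbolicForm).IsometryEquiv B') (φ' : B'.IsometryEquiv B') :
    IsWordIn {ψ' : B'.IsometryEquiv B' | ∃ α β : B'.IsometryEquiv B', ψ' = ((β.symm.trans α.symm).trans β).trans α} φ' ↔
      φ'.IsOrientationPreserving ∧ LinearMap.det (φ' : W' →ₗ[ℤ] W') = 1 := by
  refine ⟨fun h ↦ IsWordIn.isOrientationPreserving_and_det_eq_one_of_commutators hB' hnd' (fun s hs ↦ hs) h, fun h ↦ ?_⟩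
  have hφ₁ : (e.trans (φ'.trans e.symm)).IsOrientationPreserving :=
    (LinearMap.BilinForm.IsometryEquiv.isOrientationPreserving_trans_trans_symm_iff e φ').2 h.1
  have hφ₂ : LinearMap.det ((e.trans (φ'.trans e.symm) :
      ((hyperbolicForm.prod hyperbolicForm).prod hyperbolicForm).IsometryEquiv _) :
      ((Fin 2 → ℤ) × (Fin 2 → ℤ)) × (Fin 2 → ℤ) →ₗ[ℤ] ((Fin 2 → ℤ) × (Fin 2 → ℤ)) × (Fin 2 → ℤ)) = 1 := by
    rw [IsometryEquiv.det_trans_trans_symm, h.2]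
  have hw := (isWordIn_commutators_iff_threeU _).2 ⟨hφ₁, hφ₂⟩
  exact (hw.commutators_conj e).congr fun v ↦ IsometryEquiv.symm_trans_trans_trans_symm_trans_apply e φ' v

end Isometric

/-! ### §3 The standard model `U^{⊕3} = hyperbolicSum 3` -/

section HyperbolicSum

/-- **`(H ⊕ H) ⊕ H ≅ U^{⊕3}`**: the nested model is isometric to `hyperbolicSum 3` (both are even unimodular of rank `6` and
signature `0`; classification of indefinite unimodular lattices). [cite: Huybrechts2016K3, Ch. 14 Cor. 1.3 (i)] [cite: GritsenkoHulekSankaran2009, §1 ("L = 3U")] -/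
theorem nonempty_isometryEquiv_threeU_hyperbolicSum :
    Nonempty (((hyperbolicForm.prod hyperbolicForm).prod hyperbolicForm).IsometryEquiv (hyperbolicSum 3)) := by
  have hH := isSymm_hyperbolicForm
  have hs : ((hyperbolicForm.prod hyperbolicForm).prod hyperbolicForm).IsSymm := (hH.prod hH).prod hH
  have hu : ((hyperbolicForm.prod hyperbolicForm).prod hyperbolicForm).IsUnimodular :=
    isUnimodular_prod_iff.2 ⟨isUnimodular_prod_iff.2 ⟨isUnimodular_hyperbolicForm_holds, isUnimodular_hyperbolicForm_holds⟩,
      isUnimodular_hyperbolicForm_holds⟩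
  have hsig : ((hyperbolicForm.prod hyperbolicForm).prod hyperbolicForm).signature = 0 := by
    rw [signature_prod _ _ (hH.prod hH) hH, signature_prod _ _ hH hH]
    have h0 : hyperbolicForm.signature = 0 := signature_hyperbolicForm_holds
    rw [h0, add_zero, add_zero]
  have hrank : finrank ℤ (((Fin 2 → ℤ) × (Fin 2 → ℤ)) × (Fin 2 → ℤ)) = 2 * 3 := by simp
  exact equivalent_hyperbolicSum_of_signature_eq_zero _ hs hu isEven_threeU (by norm_num) hrank hsig

/-- **`O⁺(U^{⊕3})` is generated by the `(−2)`-reflections**: an isometry of `hyperbolicSum 3` is a word in the reflections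
`σ_r`, `(r,r) = −2`, iff it preserves the orientation of the positive `3`-space.
[cite: GritsenkoHulekSankaran2009, Thm. 1.1 (Kneser) and §4 ("Õ⁺(L) = ⟨S̃O⁺(L), σ_{e−f}⟩") for L = 3U] -/
theorem hyperbolicSum_three_isWordIn_negTwoReflections_iff (φ : (hyperbolicSum 3).IsometryEquiv (hyperbolicSum 3)) :
    IsWordIn {ψ : (hyperbolicSum 3).IsometryEquiv (hyperbolicSum 3) | ∃ (r : (Fin 3 → ℤ) × (Fin 3 → ℤ))
        (hr : hyperbolicSum 3 r r = -1 + -1), ψ = normTwoReflectionEquiv (isSymm_hyperbolicSum 3) r (-1) hr (by norm_num)} φ ↔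
      φ.IsOrientationPreserving := by
  obtain ⟨e⟩ := nonempty_isometryEquiv_threeU_hyperbolicSum
  exact isWordIn_negTwoReflections_iff_isOrientationPreserving_of_isometryEquiv_threeU (isSymm_hyperbolicSum 3)
    (isUnimodular_hyperbolicSum 3).nondegenerate e φ

/-- **`[O(U^{⊕3}), O(U^{⊕3})] = SO⁺(U^{⊕3})`** (so `SO⁺(U^{⊕3})` is perfect and `O(U^{⊕3})^{ab} = O/SO⁺ ≅ (ℤ/2ℤ)²`): an isometry of
`hyperbolicSum 3` is a word in commutators iff it is in `O⁺` with determinant `1`.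
[cite: GritsenkoHulekSankaran2009, Thm. 1.7 and Cor. 1.8 for L = 3U] -/
theorem hyperbolicSum_three_isWordIn_commutators_iff (φ : (hyperbolicSum 3).IsometryEquiv (hyperbolicSum 3)) :
    IsWordIn {ψ : (hyperbolicSum 3).IsometryEquiv (hyperbolicSum 3) |
        ∃ α β : (hyperbolicSum 3).IsometryEquiv (hyperbolicSum 3), ψ = ((β.symm.trans α.symm).trans β).trans α} φ ↔
      φ.IsOrientationPreserving ∧ LinearMap.det (φ : (Fin 3 → ℤ) × (Fin 3 → ℤ) →ₗ[ℤ] (Fin 3 → ℤ) × (Fin 3 → ℤ)) = 1 := by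
  obtain ⟨e⟩ := nonempty_isometryEquiv_threeU_hyperbolicSum
  exact isWordIn_commutators_iff_of_isometryEquiv_threeU (isSymm_hyperbolicSum 3) (isUnimodular_hyperbolicSum 3).nondegenerate e φ

end HyperbolicSum

end Literature.Topology.FourManifolds

end
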